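import Summits.QuantumFields.BalabanUV.T4Continuum.Support.MinimalActionClassSixNeg
import Summits.QuantumFields.BalabanUV.T4Continuum.Support.BlockAverageLoopLogPrep
import HarnessLib

/-!
# YM-DAG node N16 (NE3), the re-keyed N07 in-edge (slot key (T8)) — THE `k`-FOLD AVERAGE (43) OF THE UNIFORM-CURVATURE SCALAR («LANDAU») FIELD,
# EXACTLY: the family `U_{f,a,c}` is closed under one averaging step, uniform curvature is PRESERVED with the continuum scaling `f ↦ f·L²`
# (every `L ≥ 1`, every dimension `d + 2`, every run length)

Cell `pub-ymgap`, width seat `pub-ymgap-dag-n16-w2` (director-ym №197 ∕ HUMAN RULING D-0149), generation 6, file 1 of the g6 piece «(T8) with a `k`-UNIFORM class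
constant on the first non-flat data family».  `--kind proof --supports stmt-QuantumFields-27366 --as helper` (K3⁸, KEY MAP v2; the g0–g5 lineage keyed K3⁷ 20544 stands by
the MIS-KEY rule).  `bears_on: R4∕N16`, edge N07 → N16.  COUNT-NEUTRAL.

HONEST FRAMING.  Kernel bookkeeping + one exact computation with the tree's own transcription of [Balaban1985Averaging] (42)∕(43) (`B7Prop1Explicit.bavg`,
`B7Prop2Explicit.avgIter`) on CENTRE-VALUED («scalar», abelian) configurations (pub-balaban `T4AveragingDeficitWallBoundary` §1).  Nothing of Bałaban is asserted or
refuted; DischargeTest `stub_reg910Slot` NOT closed; no K3⁸ v6 stub named or closed; N16 ∕ N07 NOT discharged; counts UNMOVED (typed 28∕28 · discharged 5∕27 · A 5∕28).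
R4 closes the conditional finite-𝕋⁴ rung `BalabanLadder.UV` only; NOT ℝ⁴ ∕ OS ∕ mass gap; the YM mass gap (Clay) is NOT proved by any of this.

WHY.  This seat's g5 evidence (v1.1 §2 (C1)) located the content of the slot key's existence half (T8) as the `k`-UNIFORMITY of the (8)-class constant `B₃` (fixed-`k`
versions hold at the inflated radius `ε₁L^{2k}`, p620000 §1; on the FLAT moduli `B₃` is free, p620000 §2–§3; at rank two (T8) forces `B₃ ≥ 1`, dag-n16-w1 p618486∕p620319).
This file and its sequel `…N16Exists8UniformScalar` settle (C1) on the FIRST NON-FLAT family: scalar data with UNIFORM CURVATURE.  KEY FACT: (42) in the tree is the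
LOG-average `exp[L^{−d} Σ_r mlog(V(Γ_{c,q+r})V(c)⁻¹)]·V(c)`, LINEAR in the loop exponents on `scalarCfg F` inside the log branch (`bavg_scalarCfg`).

WHAT IS PROVED ([folklore], 0 `sorry`, 0 `def`).  The LANDAU FAMILY on `ℤ^{d+2}`: `F(x, e₁) = i(f·x₀ + a)`, `F(x, e₀) = i·c`, `F(x, e_μ) = 0` (`μ ≥ 2`), passed as the
hypothesis `hF` (§1–§3) and written out as a lambda in §4.  §0 `abs_phi_landau_le`, `sum_pi_fin`, `sum_coord_eq_complex`.  §1 `asum_replicate∕seg∕flatMap_seg∕treeWord_landau`,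
★ `phi_landau` (the loop exponents of (42): `−i·f·L·r₁` on `e₀`-bonds, `+i·f·L·r₀` on `e₁`-bonds, `0` else — the gauge constants cancel), `phi_landau_small` (log branch iff
`L(L−1)|f| < ln 2`).  §2 ★ `Xi_landau` (the block's FIRST MOMENT `Σ_r L^{−(d+2)} r_m = (L−1)∕2`): `Ξ(q, e₀) = −i f L(L−1)∕2`, `Ξ(q, e₁) = +i f L(L−1)∕2`, `0` else;
★ `bavg_landau`; ★★ `rescale_bavg_landau`: `rescale L (bavg L U_{f,a,c}) = U_{f·L², L·a + fL(L−1)∕2, L·c − fL(L−1)∕2}`.  §3 `landau_zero∕one∕other`, ★ `hol_plaqWord_landau`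
(UNIFORM CURVATURE: `(e₀,e₁)`-plaquettes `e^{if}·1`, `(e₁,e₀)` ones `e^{−if}·1`, all others `1`), `smallField_landau` (`SmallField U |f|`), `isUnitaryCfg_landau`.  §4 ★★★
`avgIter_landau`: `L ≥ 2`, `|f|·L^{2k} ≤ 1∕2` ⟹ `avgIter L U_{f,a,c} k = U_{f·L^{2k}, a', c'}` — the `k`-fold average of the uniform-curvature scalar field IS uniform-curvature
with curvature `f·L^{2k}`.

PRECEDENTS (cited, not restated).  pub-balaban `T4AveragingDeficitWallBoundary` §1–§2 (scalar calculus; the `L = 2` profile family `famV b δ` — §1 here is its general-`L`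
linear-profile analogue, closed under averaging); `BlockAverageLoopLogPrep.sum_coord_eq`; `NE7CentralTwist` (central constants pass the average as `z^L`); dag-n16-w3
`…N16Eq42FirstMomentGauge[Coarse]` (constant flux ⟹ the first-moment form is a coarse gauge, linearised); dag-n07-e `…N07UniformFluxHolonomy` ∕ `…K0UniformFluxConfig`
(uniform abelian flux on the ZMod-torus carriers of N07∕K0 — another carrier).  DEPENDENCES: the names opened below + `B7Prop1Explicit` (`asum_cons∕append∕gammaWord∕
plaqWord`, `seg_natCast`, `treeWord`, `boxVec`, `disp_replicate`, `stepA_true`, `expUnit`), `B7Prop2Explicit` (`avgIter_succ`, `rescale_apply`).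
-/

open scoped BigOperators Matrix Matrix.Norms.L2Operator
open NormedSpace Finset

namespace Summit.QuantumFields.YangMills.BalabanUVNodes.N16UniformScalarAverage

open Literature.MathematicalPhysics.QuantumFieldTheory.Balaban1983to89
open B7Prop1Explicit B7Prop2Explicit MatrixLog UnitaryModel
open T4AveragingDeficitWall hiding Site Plane Plaq Bond
open T4AveragingDeficitWallBoundary (scalarCfg hol_scalarCfg val_hol_scalarCfg Xi bavg_scalarCfg add_e_apply_zero add_zsmul_e_apply_zero
  add_e_zero_apply_zero add_zsmul_e_zero_apply_zero fin_one_ne_zero fin_zero_ne_one norm_real_mul_I)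
open FederbushMean (cexp_smul_one)
open Summit.QuantumFields.BalabanUV.T4Continuum
open MinimalActionClassSixNeg (isUnitaryCfg_scalarCfg_imag norm_cexp_mul_I_smul_one_sub_one_le)
open BlockAverageLoopLogPrep (sum_coord_eq)

noncomputable section

variable {d : ℕ} {n : Type*} [Fintype n] [DecidableEq n]

/-! ## §0 Two sums over the block and one bound (no configuration involved) -/

section Sums

variable {f : ℝ}

/-- The loop exponents are bounded by `L(L−1)|f|` (`r_m ≤ L − 1`). [folklore] -/
theorem abs_phi_landau_le (L : ℕ) (κ : Fin (d + 2)) (r : Fin (d + 2) → Fin L) :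
    |(if κ = 0 then -(f * L * ((r 1 : ℕ) : ℝ)) else if κ = 1 then f * L * ((r 0 : ℕ) : ℝ) else 0 : ℝ)| ≤ (L : ℝ) * ((L : ℝ) - 1) * |f| := by
  have hr : ∀ m : Fin (d + 2), ((r m : ℕ) : ℝ) ≤ (L : ℝ) - 1 := by
    intro m
    have h := (r m).isLt
    have : ((r m : ℕ) : ℝ) + 1 ≤ (L : ℝ) := by exact_mod_cast h
    linarith
  have hr0 : ∀ m : Fin (d + 2), (0 : ℝ) ≤ ((r m : ℕ) : ℝ) := fun m => by positivity
  have hL0 : (0 : ℝ) ≤ (L : ℝ) := by positivity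
  have key : ∀ m : Fin (d + 2), |f * L * ((r m : ℕ) : ℝ)| ≤ (L : ℝ) * ((L : ℝ) - 1) * |f| := by
    intro m
    rw [abs_mul, abs_mul, abs_of_nonneg hL0, abs_of_nonneg (hr0 m)]
    calc |f| * (L : ℝ) * ((r m : ℕ) : ℝ) ≤ |f| * (L : ℝ) * ((L : ℝ) - 1) := by gcongr; exact hr m
      _ = (L : ℝ) * ((L : ℝ) - 1) * |f| := by ring
  split_ifs
  · rw [abs_neg]; exact key 1
  · exact key 0
  · rw [abs_zero]
    have h1 : (0 : ℝ) ≤ (L : ℝ) * ((L : ℝ) - 1) := by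
      rcases Nat.eq_zero_or_pos L with hL | hL
      · subst hL; simp
      · have : (1 : ℝ) ≤ L := by exact_mod_cast hL
        exact mul_nonneg hL0 (by linarith)
    exact mul_nonneg h1 (abs_nonneg f)

/-- Sums over the block `[0,L)^{d+2}` of a function of ONE coordinate. [folklore] -/
theorem sum_pi_fin (L : ℕ) (i : Fin (d + 2)) (g : Fin L → ℂ) :
    ∑ r : Fin (d + 2) → Fin L, g (r i) = (L : ℂ) ^ (d + 1) * ∑ j : Fin L, g j := by
  rw [← Fintype.sum_equiv (Fin.insertNthEquiv (fun _ => Fin L) i) (fun p => g p.1) (fun r => g (r i))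
    (fun p => by simp [Fin.insertNthEquiv, Fin.insertNth_apply_same])]
  simp only [Fintype.sum_prod_type, Finset.sum_const, Finset.card_univ, Fintype.card_fun, Fintype.card_fin,
    nsmul_eq_mul, Nat.cast_pow, Finset.mul_sum]

/-- The first moment of one coordinate over the block, in `ℂ`: `Σ_{r ∈ [0,L)^{d+2}} r_m = L^{d+2}(L−1)∕2` (pub-balaban `BlockAverageLoopLogPrep.sum_coord_eq`).
[folklore] -/
theorem sum_coord_eq_complex (L : ℕ) (m : Fin (d + 2)) :
    ∑ r : Fin (d + 2) → Fin L, ((r m : ℕ) : ℂ) = (L : ℂ) ^ (d + 2) * ((L : ℂ) - 1) / 2 := by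
  have h := sum_coord_eq (d := d + 2) L m
  have h' : ((∑ r : Fin (d + 2) → Fin L, ((r m : ℕ) : ℝ) : ℝ) : ℂ) = (((L : ℝ) ^ (d + 2) * ((L : ℝ) - 1) / 2 : ℝ) : ℂ) := by rw [h]
  push_cast at h'
  exact h'

end Sums

/-! ## §1 The Landau family's path sums: straight segments, tree contours, the loop exponents of (42) -/

section PathSums

variable {F : B7Prop1Explicit.Site (d + 2) → Fin (d + 2) → ℂ} {f a c : ℝ}
  (hF : ∀ (x : B7Prop1Explicit.Site (d + 2)) (κ : Fin (d + 2)),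
    F x κ = ((if κ = 1 then f * ((x 0 : ℤ) : ℝ) + a else if κ = 0 then c else 0 : ℝ) : ℂ) * Complex.I)
include hF

/-- The exponent on `e₁`-bonds: `F(x, e₁) = i(f·x₀ + a)`. [folklore] -/
theorem landau_one (x : B7Prop1Explicit.Site (d + 2)) : F x 1 = ((f * ((x 0 : ℤ) : ℝ) + a : ℝ) : ℂ) * Complex.I := by
  rw [hF, if_pos rfl]

/-- The exponent on `e₀`-bonds: `F(x, e₀) = i·c`. [folklore] -/
theorem landau_zero (x : B7Prop1Explicit.Site (d + 2)) : F x 0 = ((c : ℝ) : ℂ) * Complex.I := by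
  rw [hF, if_neg fin_zero_ne_one, if_pos rfl]

/-- The exponent on `e_μ`-bonds, `μ ≥ 2`, vanishes. [folklore] -/
theorem landau_other (x : B7Prop1Explicit.Site (d + 2)) {κ : Fin (d + 2)} (h0 : κ ≠ 0) (h1 : κ ≠ 1) : F x κ = 0 := by
  rw [hF, if_neg h1, if_neg h0]; simp

/-- `A` along `m` forward steps in direction `κ` from `p`: `m·i(f·p₀ + a)` for `κ = e₁` (the `0`-th coordinate does not move), `m·i·c` for
`κ = e₀`, `0` otherwise. [folklore] -/
theorem asum_replicate_landau (κ : Fin (d + 2)) (m : ℕ) : ∀ p : B7Prop1Explicit.Site (d + 2),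
    asum F p (List.replicate m ((κ, true) : Letter (d + 2)))
      = if κ = 1 then (m : ℂ) * (((f * ((p 0 : ℤ) : ℝ) + a : ℝ) : ℂ) * Complex.I)
        else if κ = 0 then (m : ℂ) * (((c : ℝ) : ℂ) * Complex.I) else 0 := by
  induction m with
  | zero => intro p; simp
  | succ m ih =>
    intro p
    rw [List.replicate_succ, asum_cons, ih, stepA_true]
    by_cases hκ1 : κ = 1
    · subst hκ1
      rw [if_pos rfl, if_pos rfl, landau_one hF]
      have : (p + Letter.vec (((1 : Fin (d + 2)), true) : Letter (d + 2))) 0 = p 0 := by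
        simp [e_apply]
      rw [this]; push_cast; ring
    · rw [if_neg hκ1, if_neg hκ1]
      by_cases hκ0 : κ = 0
      · subst hκ0
        rw [if_pos rfl, if_pos rfl, landau_zero hF]; push_cast; ring
      · rw [if_neg hκ0, if_neg hκ0, landau_other hF p hκ0 hκ1, add_zero]

/-- `A([p, p + m e_κ])`. [folklore] -/
theorem asum_seg_landau (κ : Fin (d + 2)) (m : ℕ) (p : B7Prop1Explicit.Site (d + 2)) :
    asum F p (seg κ (m : ℤ))
      = if κ = 1 then (m : ℂ) * (((f * ((p 0 : ℤ) : ℝ) + a : ℝ) : ℂ) * Complex.I)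
        else if κ = 0 then (m : ℂ) * (((c : ℝ) : ℂ) * Complex.I) else 0 := by
  rw [seg_natCast, asum_replicate_landau hF]

/-- The tree part: along a duplicate-free list of directions avoiding `e₀`, only the `e₁`-segment contributes, and it sees the ORIGINAL `0`-th
coordinate. [folklore] -/
theorem asum_flatMap_seg_landau (L : ℕ) (r : Fin (d + 2) → Fin L) :
    ∀ (l : List (Fin (d + 2))) (q : B7Prop1Explicit.Site (d + 2)), (0 : Fin (d + 2)) ∉ l → l.Nodup →
      asum F q (l.flatMap fun κ => seg κ (boxVec L r κ))
        = if (1 : Fin (d + 2)) ∈ l then ((r 1 : ℕ) : ℂ) * (((f * ((q 0 : ℤ) : ℝ) + a : ℝ) : ℂ) * Complex.I) else 0 := by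
  intro l
  induction l with
  | nil => intro q _ _; simp
  | cons κ l ih =>
    intro q h0 hnd
    have hκ0 : κ ≠ 0 := fun h => h0 (h ▸ List.mem_cons_self)
    have h0l : (0 : Fin (d + 2)) ∉ l := fun h => h0 (List.mem_cons_of_mem _ h)
    have hndl : l.Nodup := (List.nodup_cons.mp hnd).2
    have hκl : κ ∉ l := (List.nodup_cons.mp hnd).1
    rw [List.flatMap_cons, asum_append, ih _ h0l hndl]
    have hbv : boxVec L r κ = ((r κ : ℕ) : ℤ) := rfl
    rw [hbv, asum_seg_landau hF, seg_natCast, disp_replicate]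
    have hq : (q + ((r κ : ℕ) : ℤ) • Letter.vec (((κ, true)) : Letter (d + 2))) 0 = q 0 := by
      simp [e_apply, Ne.symm hκ0]
    rw [hq, if_neg hκ0]
    by_cases hκ1 : κ = 1
    · subst hκ1
      rw [if_pos rfl, if_neg hκl, if_pos List.mem_cons_self, add_zero]
    · rw [if_neg hκ1, zero_add]
      have : ((1 : Fin (d + 2)) ∈ κ :: l) ↔ (1 : Fin (d + 2)) ∈ l := by
        rw [List.mem_cons]; exact ⟨fun h => h.resolve_left (fun h1 => hκ1 h1.symm), Or.inr⟩
      simp only [this]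

/-- `A(Γ^{tree}_{q, q + r}) = r₁·i(f·q₀ + a) + r₀·i·c` for `r ∈ [0,L)^{d+2}` (B5 (1.7)'s tree contour changes the coordinates in the order `d+1, …, 1, 0`,
so the `e₁`-segment runs at the original `0`-th coordinate and the `e₀`-segment comes last). [folklore] -/
theorem asum_treeWord_landau (L : ℕ) (q : B7Prop1Explicit.Site (d + 2)) (r : Fin (d + 2) → Fin L) :
    asum F q (treeWord (boxVec L r))
      = ((r 1 : ℕ) : ℂ) * (((f * ((q 0 : ℤ) : ℝ) + a : ℝ) : ℂ) * Complex.I) + ((r 0 : ℕ) : ℂ) * (((c : ℝ) : ℂ) * Complex.I) := by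
  rw [treeWord, List.finRange_succ, List.reverse_cons, List.flatMap_append, asum_append, List.flatMap_cons, List.flatMap_nil,
    List.append_nil]
  have hbv : boxVec L r 0 = ((r 0 : ℕ) : ℤ) := rfl
  rw [hbv, asum_seg_landau hF, if_neg fin_zero_ne_one, if_pos rfl]
  have h0 : (0 : Fin (d + 2)) ∉ ((List.finRange (d + 1)).map Fin.succ).reverse := by
    rw [List.mem_reverse, List.mem_map]
    rintro ⟨j, _, hj⟩
    exact Fin.succ_ne_zero j hj
  have hnd : (((List.finRange (d + 1)).map Fin.succ).reverse).Nodup :=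
    List.nodup_reverse.mpr ((List.nodup_finRange _).map (Fin.succ_injective _))
  have h1 : (1 : Fin (d + 2)) ∈ ((List.finRange (d + 1)).map Fin.succ).reverse := by
    rw [List.mem_reverse, List.mem_map]
    exact ⟨0, List.mem_finRange 0, rfl⟩
  rw [asum_flatMap_seg_landau hF L r _ q h0 hnd, if_pos h1]

/-- **★ THE LOOP EXPONENTS OF (42) ON THE LANDAU FAMILY**: `A(Γ_{c,x_r}) − A(c) = −i·f·L·r₁` on `e₀`-bonds, `+i·f·L·r₀` on `e₁`-bonds, `0` on all other
bonds — the gauge constants `a`, `c` cancel (the loop `Γ_{c,x_r} ∪ (−Γ_c)` is closed) and what is left is `f ×` the signed `(e₀,e₁)`-area of the loop.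
[cite: Balaban1985Averaging, (42) p.23] -/
theorem phi_landau (L : ℕ) (q : B7Prop1Explicit.Site (d + 2)) (κ : Fin (d + 2)) (r : Fin (d + 2) → Fin L) :
    asum F q (gammaWord L κ (boxVec L r)) - asum F q (seg κ (L : ℤ))
      = ((if κ = 0 then -(f * L * ((r 1 : ℕ) : ℝ)) else if κ = 1 then f * L * ((r 0 : ℕ) : ℝ) else 0 : ℝ) : ℂ) * Complex.I := by
  rw [asum_gammaWord, asum_treeWord_landau hF, asum_treeWord_landau hF, asum_seg_landau hF κ L (q + boxVec L r),
    asum_seg_landau hF κ L q]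
  have hq : (q + boxVec L r) 0 = q 0 + ((r 0 : ℕ) : ℤ) := by simp [boxVec]
  by_cases hκ0 : κ = 0
  · subst hκ0
    have hq0 : (q + (L : ℤ) • e (0 : Fin (d + 2))) 0 = q 0 + L := add_zsmul_e_zero_apply_zero q L
    simp only [fin_zero_ne_one, if_false, if_true, hq0]
    push_cast; ring
  · by_cases hκ1 : κ = 1
    · subst hκ1
      simp only [fin_one_ne_zero, if_false, if_true, hq, add_zsmul_e_apply_zero fin_one_ne_zero]
      push_cast; ring
    · simp only [hκ0, hκ1, if_false, add_zsmul_e_apply_zero hκ0]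
      push_cast; ring

/-- All loop exponents of (42) on the Landau family lie inside the log branch as soon as `L(L−1)|f| < ln 2`. [folklore] -/
theorem phi_landau_small (L : ℕ) (hfL : (L : ℝ) * ((L : ℝ) - 1) * |f| < Real.log 2) (q : B7Prop1Explicit.Site (d + 2)) (κ : Fin (d + 2))
    (r : Fin (d + 2) → Fin L) :
    ‖asum F q (gammaWord L κ (boxVec L r)) - asum F q (seg κ (L : ℤ))‖ < Real.log 2 := by
  rw [phi_landau hF, norm_real_mul_I]
  exact (abs_phi_landau_le (f := f) L κ r).trans_lt hfL

/-! ## §2 The average (42) of the Landau family: the first moment of the block -/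

/-- **★ THE EXPONENT OF (42) ON THE LANDAU FAMILY**: `Ξ(q, e₀) = −i·f·L(L−1)∕2`, `Ξ(q, e₁) = +i·f·L(L−1)∕2`, `Ξ(q, e_μ) = 0` (`μ ≥ 2`) — independent of
`q`, `a`, `c`. [cite: Balaban1985Averaging, (42) p.23] -/
theorem Xi_landau (L : ℕ) (hL : 1 ≤ L) (q : B7Prop1Explicit.Site (d + 2)) (κ : Fin (d + 2)) :
    Xi L F q κ = ((if κ = 0 then -(f * L * ((L : ℝ) - 1) / 2) else if κ = 1 then f * L * ((L : ℝ) - 1) / 2 else 0 : ℝ) : ℂ) * Complex.I := by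
  have hL0 : (L : ℂ) ≠ 0 := by exact_mod_cast (show L ≠ 0 by omega)
  have hLd : (L : ℂ) ^ (d + 2) ≠ 0 := pow_ne_zero _ hL0
  unfold Xi
  simp_rw [phi_landau hF]
  by_cases hκ0 : κ = 0
  · simp_rw [if_pos hκ0]
    have : ∀ r : Fin (d + 2) → Fin L, ((L : ℂ) ^ (d + 2))⁻¹ * ((((-(f * L * ((r 1 : ℕ) : ℝ))) : ℝ) : ℂ) * Complex.I)
        = ((r 1 : ℕ) : ℂ) * (-(((L : ℂ) ^ (d + 2))⁻¹ * f * L * Complex.I)) := by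
      intro r; push_cast; ring
    rw [Finset.sum_congr rfl fun r _ => this r, ← Finset.sum_mul, sum_coord_eq_complex]
    push_cast
    field_simp
  · simp_rw [if_neg hκ0]
    by_cases hκ1 : κ = 1
    · simp_rw [if_pos hκ1]
      have : ∀ r : Fin (d + 2) → Fin L, ((L : ℂ) ^ (d + 2))⁻¹ * ((((f * L * ((r 0 : ℕ) : ℝ)) : ℝ) : ℂ) * Complex.I)
          = ((r 0 : ℕ) : ℂ) * (((L : ℂ) ^ (d + 2))⁻¹ * f * L * Complex.I) := by
        intro r; push_cast; ring
      rw [Finset.sum_congr rfl fun r _ => this r, ← Finset.sum_mul, sum_coord_eq_complex]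
      push_cast
      field_simp
    · simp_rw [if_neg hκ1]
      simp

/-- **★ (42) EVALUATED ON THE LANDAU FAMILY** (`L ≥ 1`, log branch `L(L−1)|f| < ln 2`): `V̄(q, e₁) = e^{i(L(f·q₀ + a) + fL(L−1)∕2)}·1`,
`V̄(q, e₀) = e^{i(L·c − fL(L−1)∕2)}·1`, `V̄(q, e_μ) = 1` (`μ ≥ 2`). [cite: Balaban1985Averaging, (42) p.23] -/
theorem bavg_landau [Nonempty n] (L : ℕ) (hL : 1 ≤ L) (hfL : (L : ℝ) * ((L : ℝ) - 1) * |f| < Real.log 2)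
    (q : B7Prop1Explicit.Site (d + 2)) (κ : Fin (d + 2)) :
    bavg L (scalarCfg (n := n) F) q κ
      = expUnit (((((if κ = 1 then (L : ℝ) * (f * ((q 0 : ℤ) : ℝ) + a) + f * L * ((L : ℝ) - 1) / 2
          else if κ = 0 then (L : ℝ) * c - f * L * ((L : ℝ) - 1) / 2 else 0 : ℝ) : ℂ) * Complex.I)) • (1 : Matrix n n ℂ)) := by
  rw [bavg_scalarCfg L F q κ (phi_landau_small hF L hfL q κ)]
  have key : Xi L F q κ + asum F q (seg κ (L : ℤ))
      = (((if κ = 1 then (L : ℝ) * (f * ((q 0 : ℤ) : ℝ) + a) + f * L * ((L : ℝ) - 1) / 2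
          else if κ = 0 then (L : ℝ) * c - f * L * ((L : ℝ) - 1) / 2 else 0 : ℝ) : ℂ) * Complex.I) := by
    rw [Xi_landau hF L hL, asum_seg_landau hF κ L q]
    by_cases hκ0 : κ = 0
    · subst hκ0
      simp only [fin_zero_ne_one, if_false, if_true]
      push_cast; ring
    · by_cases hκ1 : κ = 1
      · subst hκ1
        simp only [fin_one_ne_zero, if_false, if_true]
        push_cast; ring
      · simp only [hκ0, hκ1, if_false]
        push_cast; ring
  rw [key]

/-- **★★ THE LANDAU FAMILY IS CLOSED UNDER ONE AVERAGING STEP, WITH CURVATURE `f ↦ f·L²`**: read on the next unit lattice,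
`rescale L (bavg L U_{f,a,c}) = U_{f·L², L·a + fL(L−1)∕2, L·c − fL(L−1)∕2}` (`L ≥ 1`, log branch `L(L−1)|f| < ln 2`). [cite: Balaban1985Averaging, (42)–(43) pp.23–24] -/
theorem rescale_bavg_landau [Nonempty n] (L : ℕ) (hL : 1 ≤ L) (hfL : (L : ℝ) * ((L : ℝ) - 1) * |f| < Real.log 2) :
    rescale L (bavg L (scalarCfg (n := n) F))
      = scalarCfg (n := n) (fun (z : B7Prop1Explicit.Site (d + 2)) (κ : Fin (d + 2)) =>
          ((if κ = 1 then (f * (L : ℝ) ^ 2) * ((z 0 : ℤ) : ℝ) + ((L : ℝ) * a + f * L * ((L : ℝ) - 1) / 2)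
            else if κ = 0 then (L : ℝ) * c - f * L * ((L : ℝ) - 1) / 2 else 0 : ℝ) : ℂ) * Complex.I) := by
  funext z κ
  rw [rescale_apply, bavg_landau hF L hL hfL]
  unfold scalarCfg
  have hz : (((L : ℤ) • z) 0 : ℤ) = (L : ℤ) * z 0 := by simp
  rw [hz]
  congr 3
  by_cases hκ1 : κ = 1
  · rw [if_pos hκ1, if_pos hκ1]; push_cast; ring
  · rw [if_neg hκ1, if_neg hκ1]

end PathSums

/-! ## §3 Kinematics of the Landau family: uniform curvature, the small-field radius, unitarity -/

section Kinematics

variable {F : B7Prop1Explicit.Site (d + 2) → Fin (d + 2) → ℂ} {f a c : ℝ}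
  (hF : ∀ (x : B7Prop1Explicit.Site (d + 2)) (κ : Fin (d + 2)),
    F x κ = ((if κ = 1 then f * ((x 0 : ℤ) : ℝ) + a else if κ = 0 then c else 0 : ℝ) : ℂ) * Complex.I)
include hF

/-- **★ UNIFORM CURVATURE**: every `(e₀, e₁)`-plaquette variable of the Landau field is `e^{if}·1`, every `(e₁, e₀)`-one is `e^{−if}·1`, and every other
plaquette variable is `1`. [cite: Balaban1985Averaging, (9) p.18, (44) p.24] -/
theorem hol_plaqWord_landau (x : B7Prop1Explicit.Site (d + 2)) (κ μ : Fin (d + 2)) :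
    hol (scalarCfg (n := n) F) x (plaqWord κ μ)
      = expUnit ((((if κ = 0 ∧ μ = 1 then f else if κ = 1 ∧ μ = 0 then -f else 0 : ℝ) : ℂ) * Complex.I) • (1 : Matrix n n ℂ)) := by
  rw [hol_scalarCfg, asum_plaqWord]
  congr 2
  have hx0 : ∀ ν : Fin (d + 2), ((x + e ν) 0 : ℤ) = x 0 + if ν = 0 then 1 else 0 := by
    intro ν
    rw [Pi.add_apply, e_apply]
    by_cases h : ν = 0
    · rw [if_pos h, if_pos h.symm]
    · rw [if_neg h, if_neg (Ne.symm h)]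
  rw [hF x κ, hF (x + e κ) μ, hF (x + e μ) κ, hF x μ, hx0 κ, hx0 μ]
  by_cases hκ0 : κ = 0 <;> by_cases hκ1 : κ = 1 <;> by_cases hμ0 : μ = 0 <;> by_cases hμ1 : μ = 1
  all_goals (first | (exfalso; exact fin_zero_ne_one (hκ0.symm.trans hκ1)) | (exfalso; exact fin_zero_ne_one (hμ0.symm.trans hμ1)) | skip)
  all_goals (simp only [hκ0, hκ1, hμ0, hμ1, fin_zero_ne_one, fin_one_ne_zero, if_true, if_false, and_true, and_false]; push_cast; ring)

/-- The Landau field is in the small-field class of radius `|f|`: `‖U(∂p) − 1‖ ≤ |f|` for every plaquette. [folklore] -/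
theorem smallField_landau [Nonempty n] : SmallField (scalarCfg (n := n) F) |f| := by
  intro x κ μ _
  rw [hol_plaqWord_landau hF, val_expUnit, ← cexp_smul_one]
  refine (norm_cexp_mul_I_smul_one_sub_one_le _).trans ?_
  split_ifs
  · exact le_rfl
  · rw [abs_neg]
  · rw [abs_zero]; exact abs_nonneg f

/-- The Landau field is `U(N)`-valued (purely imaginary exponents). [folklore] -/
theorem isUnitaryCfg_landau : IsUnitaryCfg (scalarCfg (n := n) F) := by
  have hF' : F = fun x κ => (((if κ = 1 then f * ((x 0 : ℤ) : ℝ) + a else if κ = 0 then c else 0 : ℝ) : ℝ) : ℂ) * Complex.I := by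
    funext x κ; exact hF x κ
  rw [hF']
  exact isUnitaryCfg_scalarCfg_imag _

end Kinematics

/-! ## §4 The `k`-fold average (43) of the Landau field -/

/-- **★★★ THE `k`-FOLD AVERAGE (43) OF THE UNIFORM-CURVATURE SCALAR FIELD IS A UNIFORM-CURVATURE SCALAR FIELD WITH CURVATURE `f·L^{2k}`**: for `L ≥ 2` and
`|f|·L^{2k} ≤ 1∕2` (so that every intermediate level is inside the log branch), `avgIter L U_{f,a,c} k = U_{f·L^{2k}, a', c'}` for some constants `a', c'`.
[cite: Balaban1985Averaging, (43) p.24] -/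
theorem avgIter_landau [Nonempty n] (L : ℕ) (hL : 2 ≤ L) (f a c : ℝ) :
    ∀ k : ℕ, |f| * (L : ℝ) ^ (2 * k) ≤ 1 / 2 →
      ∃ a' c' : ℝ, avgIter L (scalarCfg (n := n) (fun (x : B7Prop1Explicit.Site (d + 2)) (κ : Fin (d + 2)) =>
          ((if κ = 1 then f * ((x 0 : ℤ) : ℝ) + a else if κ = 0 then c else 0 : ℝ) : ℂ) * Complex.I)) k
        = scalarCfg (n := n) (fun (x : B7Prop1Explicit.Site (d + 2)) (κ : Fin (d + 2)) =>
          ((if κ = 1 then (f * (L : ℝ) ^ (2 * k)) * ((x 0 : ℤ) : ℝ) + a' else if κ = 0 then c' else 0 : ℝ) : ℂ) * Complex.I)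
  | 0, _ => ⟨a, c, by simp⟩
  | k + 1, hk => by
    have hL1 : (1 : ℝ) ≤ L := by exact_mod_cast (show 1 ≤ L by omega)
    have hL0 : (0 : ℝ) ≤ L := by positivity
    have hpow : (L : ℝ) ^ (2 * k) ≤ (L : ℝ) ^ (2 * (k + 1)) := pow_le_pow_right₀ hL1 (by omega)
    have hk' : |f| * (L : ℝ) ^ (2 * k) ≤ 1 / 2 := (mul_le_mul_of_nonneg_left hpow (abs_nonneg f)).trans hk
    obtain ⟨a', c', h⟩ := avgIter_landau L hL f a c k hk'
    -- the log branch at level `k`: `L(L−1)·|f L^{2k}| ≤ L²·L^{2k}|f| = L^{2(k+1)}|f| ≤ 1∕2 < ln 2`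
    have hbranch : (L : ℝ) * ((L : ℝ) - 1) * |f * (L : ℝ) ^ (2 * k)| < Real.log 2 := by
      have hlog : (1 : ℝ) / 2 < Real.log 2 := by have := Real.log_two_gt_d9; linarith
      have h1 : (L : ℝ) * ((L : ℝ) - 1) ≤ (L : ℝ) ^ 2 := by nlinarith
      have h2 : |f * (L : ℝ) ^ (2 * k)| = |f| * (L : ℝ) ^ (2 * k) := by
        rw [abs_mul, abs_of_nonneg (by positivity : (0 : ℝ) ≤ (L : ℝ) ^ (2 * k))]
      have h3 : (L : ℝ) ^ 2 * (|f| * (L : ℝ) ^ (2 * k)) = |f| * (L : ℝ) ^ (2 * (k + 1)) := by ring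
      calc (L : ℝ) * ((L : ℝ) - 1) * |f * (L : ℝ) ^ (2 * k)|
          ≤ (L : ℝ) ^ 2 * (|f| * (L : ℝ) ^ (2 * k)) := by
            rw [h2]; exact mul_le_mul_of_nonneg_right h1 (by positivity)
        _ = |f| * (L : ℝ) ^ (2 * (k + 1)) := h3
        _ < Real.log 2 := hk.trans_lt hlog
    refine ⟨(L : ℝ) * a' + f * (L : ℝ) ^ (2 * k) * L * ((L : ℝ) - 1) / 2, (L : ℝ) * c' - f * (L : ℝ) ^ (2 * k) * L * ((L : ℝ) - 1) / 2, ?_⟩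
    rw [avgIter_succ, h, rescale_bavg_landau (f := f * (L : ℝ) ^ (2 * k)) (a := a') (c := c') (fun _ _ => rfl) L (by omega) hbranch]
    congr 1
    funext x κ
    by_cases hκ1 : κ = 1
    · rw [if_pos hκ1, if_pos hκ1]; push_cast; ring
    · rw [if_neg hκ1, if_neg hκ1]

end

end Summit.QuantumFields.YangMills.BalabanUVNodes.N16UniformScalarAverage
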